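import Summits.CriticalPhenomena.PercolationContinuityZ3.Theorems.Transplant.SkelFrmFromBParamsFaceCountsRangeYA
import Summits.CriticalPhenomena.PercolationContinuityZ3.Theorems.Transplant.SkelFrmBParamsFaceCountsRangeYA
import Summits.CriticalPhenomena.PercolationContinuityZ3.Theorems.Transplant.SkelFrmFromBParamsFaceFloorsClrYA
import Summits.CriticalPhenomena.PercolationContinuityZ3.Theorems.Transplant.SkelFrmBParamsFaceFloorsClrYA
import Summits.CriticalPhenomena.PercolationContinuityZ3.Theorems.Transplant.SkelFrmFromBParamsFaceFloorsZPiYA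
import Summits.CriticalPhenomena.PercolationContinuityZ3.Theorems.Transplant.SkelFrmBParamsFaceFloorsZPiYA
import Summits.CriticalPhenomena.PercolationContinuityZ3.Theorems.Transplant.PlanarSkeletonFrmFromDefs
import Summits.CriticalPhenomena.PercolationContinuityZ3.Theorems.Transplant.PlanarSkeletonFrmDefs
import Summits.CriticalPhenomena.PercolationContinuityZ3.Theorems.Transplant.SkelPhiStepIDataNS
import HarnessLib
import Summits.CriticalPhenomena.PercolationContinuityZ3.Theorems.Transplant.SkelFrmBParamsFaceFloorsPinYA
/-!
# U-WAVE PORT (RULING D-U, lead g21 2026-08-26; WAVE-U-MANIFEST v3.1 row «SkelFrmBParamsFaceFloorsPinYA» ↦ «SkelFrmFromBParamsFaceFloorsPinYA») of the tree module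
# `Transplant/SkelFrmBParamsFaceFloorsPinYA` onto the carrier `PlanarSkeletonFrmFrom` (frames only, cylinders connected from width `ℓ₀` on)

ORIGINAL TITLE: (F) VALUE LAYER, N2 twin (hp-8 g42, 2026-08-23; F-DISCHARGE-MAP-N2 G18 y′-face `hclr₃`/`hπ2Y`/`hπ3Y` AT THE COUNTS): `port_frm.py` text of N1

builds on p205010 (kernel theorem, internal audit signed; external expert review pending) — nothing in this file uses p205010; NOTHING is claimed about the
OPEN node U `SamePDropOfSkeletonFrmFrom₁` (nor U_s / the end state).  Lane `prim-bschramm`, seat `prim-bschramm-stmt` gen 26 (port pen, RULING M-11 family P-stmt; tool = p3-g26's port_u.py of record, registry-driven inputs); helper file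
(`--supports stmt-CriticalPhenomena-4575 --as helper`).  PORT RULES r1–r4 of RULING D-U: declaration order and proof texts are those of the original,
byte-identical except (i) the carrier token `PlanarSkeletonFrm ↦ PlanarSkeletonFrmFrom` (binders, `namespace`/`end` lines, qualified names of twinned
declarations), (ii) carrier-FREE declarations of the original (φ-level `Skelφ…` blocks and namespace-only arithmetic residents) are NOT re-declared —
this file imports the original and `export`s the twin-free residents (POLICY T / treatment (m1)); residents whose statement mentions a twinned
constant are copied, (iii) every carrier-binding declaration keeps its explicit binder `(Φ : PlanarSkeletonFrmFrom G)` in its own signature (r2).  Docstrings and citations are the original's.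
-/

noncomputable section

open scoped Classical

namespace Summit.CriticalPhenomena.PercolationContinuityZ3.Theorems.Transplant

namespace PlanarSkeletonFrmFrom

namespace NegB

open Literature.Probability.Percolation Literature.Probability.LatticeModels SimpleGraph
open Literature.Probability.Percolation.KozmaNitzan.Cells (oth sgOf sgOf_sign)
open SkelConc (Consts)
open Skelφ (shearUnit xBoxLoA xBoxHiA xBoxB crossOffY yPrmW)
open Skelφ.StepI (DataN)
open TwoAxis.Para (modulus)
open Neg

namespace KS

section PinY

/-- **M3 y′-face field `hclr₃` at hp-8's counts** (`FloorsY2.hclr₃`, `σT := σTY`, `N₃ := N3Y`, `Nr := NrY`; `qB₃′` generic): every region of the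
tangential x-run is clear of the seed box by LEVEL. [cite: KozmaNitzan2024, §4 Lemma 12 (pp. 23–25)] [cite: MartineauTassion2017, §4.3 Lemma 4.2] -/
theorem hclr₃_YA (κ : Consts) {V : Type} [DecidableEq V] [Countable V] {G : SimpleGraph V} [G.LocallyFinite] (Φ : PlanarSkeletonFrmFrom G) (t : V) (p : unitInterval) (D : Skelφ.StepI.DataNS V) (mk : ℕ) (g : ℕ) (f : ℕ) (P : PCells2T) (hP : P.toPCells2 = fcellsA κ Φ t p D g f) (hN : EqNumL κ Φ t p D g f) (hκ : (hL κ Φ t p D g f).natAbs ≤ 10 * nL κ Φ t p D g f)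
    (hℓA : 22000 * Neg.Kq κ * (KS0.R'0 κ Φ t p D mk + 2) ≤ ℓL κ Φ t p D g f)
    (x : Site 2) (du : MDir) (hd : du.1 = 1) (j : ℕ) (hj : j < P.K) (z : Site 2) {E : ℕ} {kE : ℤ}
    (hlev1 : P.faceL 1 j - E ≤ P.lev du x z) (hlev2 : P.lev du x z ≤ P.faceL 1 j + E)
    (hz : |z 0 - P.cenS x 0| ≤ kE) (hEu : (E : ℤ) ≤ u₁A κ Φ t p D g f) (hkE : kE ≤ 5 * (P.r 0 : ℤ))
    (yL : Site 2) (he0 : |FcA κ Φ t p D g f yL| ≤ 6 * u₀A κ Φ t p D g f) (he1 : |F1cA κ Φ t p D g f yL| ≤ 6 * u₁A κ Φ t p D g f) (qB₃ : ℕ) :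
    ∀ k ≤ N3Y κ Φ t p D g f P yL x du z,
      (∀ b : ℤ, min (σTY κ Φ t p D g f P yL x du z * xBoxLoA (nL κ Φ t p D g f) qB₃ (KS0.R'0 κ Φ t p D mk) k) (σTY κ Φ t p D g f P yL x du z * xBoxHiA (nL κ Φ t p D g f) qB₃ (KS0.R'0 κ Φ t p D mk) k) ≤ b →
        b ≤ max (σTY κ Φ t p D g f P yL x du z * xBoxLoA (nL κ Φ t p D g f) qB₃ (KS0.R'0 κ Φ t p D mk) k) (σTY κ Φ t p D g f P yL x du z * xBoxHiA (nL κ Φ t p D g f) qB₃ (KS0.R'0 κ Φ t p D mk) k) →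
        ((Mu D : ℕ) : ℤ) < |b + (yL + crossOffY (nL κ Φ t p D g f) (ℓL κ Φ t p D g f) (hL κ Φ t p D g f) (vL κ Φ t p D g f) (sgOf du) (NrY κ Φ t p D g f P yL x du z)) 0|) ∨
      ((shearUnit (nL κ Φ t p D g f) (hL κ Φ t p D g f) : ℤ) * (Mu D) +
          (shearUnit (nL κ Φ t p D g f) (hL κ Φ t p D g f) : ℤ) * (xBoxB (nL κ Φ t p D g f) (ℓL κ Φ t p D g f) (hL κ Φ t p D g f) (KS0.R'0 κ Φ t p D mk) k + 1) ≤
        |(nL κ Φ t p D g f : ℤ) * (yL + crossOffY (nL κ Φ t p D g f) (ℓL κ Φ t p D g f) (hL κ Φ t p D g f) (vL κ Φ t p D g f) (sgOf du) (NrY κ Φ t p D g f P yL x du z)) 1 -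
          hL κ Φ t p D g f * (yL + crossOffY (nL κ Φ t p D g f) (ℓL κ Φ t p D g f) (hL κ Φ t p D g f) (vL κ Φ t p D g f) (sgOf du) (NrY κ Φ t p D g f P yL x du z)) 0|) := by
  have hu0 : 1 ≤ u₀A κ Φ t p D g f := (units_eqA κ Φ t p D g f).2.2.2.2.1
  have hu1 : 1 ≤ u₁A κ Φ t p D g f := (units_eqA κ Φ t p D g f).2.2.2.2.2
  have hNr := clr_NrY_lb κ Φ t p D g f P hP x du hd z hj hlev1 hlev2 yL he1 (by linarith)
  have hN3 := N3Y_range κ Φ t p D g f P hP yL x du hd z hz hkE he0 (by linarith)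
  have hNr' : 13 ≤ NrY κ Φ t p D g f P yL x du z := by
    have hq : (1 : ℤ) ≤ (Neg.Kq κ : ℤ) := by exact_mod_cast Neg.one_le_Kq κ
    have : (13 : ℤ) ≤ (NrY κ Φ t p D g f P yL x du z : ℤ) := by linarith
    exact_mod_cast this
  have hN3' : N3Y κ Φ t p D g f P yL x du z + 2 ≤ 2000 * Neg.Kq κ := by have := Neg.one_le_Kq κ; omega
  exact hclr₃_YA_gen κ Φ t p D mk g f hN hκ hℓA du yL (by linarith) hNr' hN3' (σTY κ Φ t p D g f P yL x du z) qB₃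

/-- **M3 y′-face field `hπ2Y` at hp-8's counts** (`Nr := NrY`; `qB′`, `r` generic with the ONE r-floor `hr`). [cite: KozmaNitzan2024, §4 Lemma 12 (pp. 23–25)] -/
theorem hπ2Y_YA (κ : Consts) {V : Type} [DecidableEq V] [Countable V] {G : SimpleGraph V} [G.LocallyFinite] (Φ : PlanarSkeletonFrmFrom G) (t : V) (p : unitInterval) (D : Skelφ.StepI.DataNS V) (c : ℕ) (mk : ℕ) (g : ℕ) (f : ℕ) (P : PCells2T) (hP : P.toPCells2 = fcellsA κ Φ t p D g f) (hN : EqNumL κ Φ t p D g f) (hκ : (hL κ Φ t p D g f).natAbs ≤ 10 * nL κ Φ t p D g f)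
    (hℓA : 22000 * Neg.Kq κ * (KS0.R'0 κ Φ t p D mk + 2) ≤ ℓL κ Φ t p D g f)
    (x : Site 2) (du : MDir) (hd : du.1 = 1) (j : ℕ) (hj : j < P.K) (z : Site 2) {E : ℕ}
    (hlev1 : P.faceL 1 j - E ≤ P.lev du x z) (hlev2 : P.lev du x z ≤ P.faceL 1 j + E)
    (hEu : (E : ℤ) ≤ u₁A κ Φ t p D g f) (yL : Site 2) (he1 : |F1cA κ Φ t p D g f yL| ≤ 6 * u₁A κ Φ t p D g f)
    (hyl : (yL 0).natAbs + (yL 1).natAbs ≤ YbF κ Φ t p D c mk g f + 11 * nL κ Φ t p D g f) (qB : ℕ) (r : ℕ) (hr : πBudY κ Φ t p D c mk g f ≤ r) :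
    ∀ k ≤ NrY κ Φ t p D g f P yL x du z, ((yL 0).natAbs + (yL 1).natAbs) + (((((k + 1 : ℕ) : ℤ) * vL κ Φ t p D g f).natAbs +
      (((shearUnit (nL κ Φ t p D g f) (hL κ Φ t p D g f) : ℤ) * |((k + 1 : ℕ) : ℤ) * (yPrmW (nL κ Φ t p D g f) (ℓL κ Φ t p D g f) (hL κ Φ t p D g f) (vL κ Φ t p D g f) (KS0.R'0 κ Φ t p D mk) qB (NrY κ Φ t p D g f P yL x du z)).sLo| +
        |hL κ Φ t p D g f| * |((k + 1 : ℕ) : ℤ) * vL κ Φ t p D g f| + shearUnit (nL κ Φ t p D g f) (hL κ Φ t p D g f)) / nL κ Φ t p D g f).natAbs + 1)) ≤ r := by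
  have hu1 : 1 ≤ u₁A κ Φ t p D g f := (units_eqA κ Φ t p D g f).2.2.2.2.2
  obtain ⟨-, hNr⟩ := NrY_range κ Φ t p D g f P hP x du hd z hj hlev1 hlev2 yL he1 (by linarith)
  have hNr' : NrY κ Φ t p D g f P yL x du z + 1 ≤ 1000 * Neg.Kq κ := by have := Neg.one_le_Kq κ; omega
  exact hπ2Y_YA_gen κ Φ t p D c mk g f hN hκ hℓA yL hyl hNr' qB r hr

/-- **M3 y′-face field `hπ3Y` at hp-8's counts** (`Nr := NrY`, `N₃ := N3Y`; `r` generic with `hr`). [cite: KozmaNitzan2024, §4 Lemma 12 (pp. 23–25)] -/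
theorem hπ3Y_YA (κ : Consts) {V : Type} [DecidableEq V] [Countable V] {G : SimpleGraph V} [G.LocallyFinite] (Φ : PlanarSkeletonFrmFrom G) (t : V) (p : unitInterval) (D : Skelφ.StepI.DataNS V) (c : ℕ) (mk : ℕ) (g : ℕ) (f : ℕ) (P : PCells2T) (hP : P.toPCells2 = fcellsA κ Φ t p D g f) (hN : EqNumL κ Φ t p D g f) (hκ : (hL κ Φ t p D g f).natAbs ≤ 10 * nL κ Φ t p D g f)
    (hℓA : 22000 * Neg.Kq κ * (KS0.R'0 κ Φ t p D mk + 2) ≤ ℓL κ Φ t p D g f)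
    (x : Site 2) (du : MDir) (hd : du.1 = 1) (j : ℕ) (hj : j < P.K) (z : Site 2) {E : ℕ} {kE : ℤ}
    (hlev1 : P.faceL 1 j - E ≤ P.lev du x z) (hlev2 : P.lev du x z ≤ P.faceL 1 j + E)
    (hz : |z 0 - P.cenS x 0| ≤ kE) (hEu : (E : ℤ) ≤ u₁A κ Φ t p D g f) (hkE : kE ≤ 5 * (P.r 0 : ℤ))
    (yL : Site 2) (he0 : |FcA κ Φ t p D g f yL| ≤ 6 * u₀A κ Φ t p D g f) (he1 : |F1cA κ Φ t p D g f yL| ≤ 6 * u₁A κ Φ t p D g f)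
    (hyl : (yL 0).natAbs + (yL 1).natAbs ≤ YbF κ Φ t p D c mk g f + 11 * nL κ Φ t p D g f) (r : ℕ) (hr : πBudY κ Φ t p D c mk g f ≤ r) :
    (((yL + crossOffY (nL κ Φ t p D g f) (ℓL κ Φ t p D g f) (hL κ Φ t p D g f) (vL κ Φ t p D g f) (sgOf du) (NrY κ Φ t p D g f P yL x du z)) 0).natAbs +
        ((yL + crossOffY (nL κ Φ t p D g f) (ℓL κ Φ t p D g f) (hL κ Φ t p D g f) (vL κ Φ t p D g f) (sgOf du) (NrY κ Φ t p D g f P yL x du z)) 1).natAbs) +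
      (N3Y κ Φ t p D g f P yL x du z + 1) * shearUnit (nL κ Φ t p D g f) (hL κ Φ t p D g f) ≤ r := by
  have hu0 : 1 ≤ u₀A κ Φ t p D g f := (units_eqA κ Φ t p D g f).2.2.2.2.1
  have hu1 : 1 ≤ u₁A κ Φ t p D g f := (units_eqA κ Φ t p D g f).2.2.2.2.2
  obtain ⟨-, hNr⟩ := NrY_range κ Φ t p D g f P hP x du hd z hj hlev1 hlev2 yL he1 (by linarith)
  have hN3 := N3Y_range κ Φ t p D g f P hP yL x du hd z hz hkE he0 (by linarith)
  have hq := Neg.one_le_Kq κ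
  have hNr' : NrY κ Φ t p D g f P yL x du z + 1 ≤ 1000 * Neg.Kq κ := by omega
  have hN3' : N3Y κ Φ t p D g f P yL x du z + 1 ≤ 1000 * Neg.Kq κ := by omega
  exact hπ3Y_YA_gen κ Φ t p D c mk g f hN hκ hℓA du yL hyl hNr' hN3' r hr

end PinY

end KS

end NegB

end PlanarSkeletonFrmFrom

end Summit.CriticalPhenomena.PercolationContinuityZ3.Theorems.Transplant

end
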